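import Literature.NumberTheory.Automorphic.ReductiveDual
import Literature.NumberTheory.Automorphic.ReductiveDualRankOne
import Literature.NumberTheory.Automorphic.RootDataProofs
import HarnessLib

/-!
# `roots_isReduced` from the existence of a reduced root datum (trunk T-AUTOMORPHIC, G25 AutomorphicL)

A consistency link between two named facts of the Automorphic topic, observed in the review of
`RootDataProofs.lean`: the statement-level fact `Literature.NumberTheory.Automorphic.exists_isRootDatumOf`
(`ReductiveDual.lean`, lang.S13 (b): a connected reductive group with a maximal torus over an
algebraically closed field *has* a reduced root datum; SGA 3 XXII 1.14, Springer 7.4.3 with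
8.1.1–8.1.3) already implies Springer's Lemma 7.4.4 in the form `roots_isReduced`
(`RootDataProofs.lean`), because the roots of any such datum are the roots of `(G, T)`
(`IsRootDatumOf.range_root`) and the character lattice of `T` is torsion-free
(`isMulTorsionFree_characterLattice`). Consequently the fact `isReduced_of_isRootDatumOf` of
`RootData.lean` (reducedness of *every* root pairing that is the root datum of `(G, T)`) also
follows from `exists_isRootDatumOf` (`isReduced_of_isRootDatumOf_of_exists_isRootDatumOf`).
Both theorems are proved; no new facts. This does not discharge anything by itself — it records
that the unproved leaves `exists_isRootDatumOf ⟹ roots_isReduced ⟹ isReduced_of_isRootDatumOf`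
are linearly ordered (Springer proves 7.4.4 first).

The structural route to 7.4.4 is `roots_isReduced_of_facts` (`ReductiveDualRankOne.lean`: from
Springer 7.6.4 (i), `isConnectedReductive_centralizer_torus`, and the two semisimple-rank-one
facts `atMostTwo_isBorelIn_of_central` (7.1.4, 6.4.12) and
`exists_rootHom_sup_isBorelIn_of_central` (7.3.2–7.3.3 (ii)) of `RootSubgroupProofs.lean`);
composed with `isReduced_of_isRootDatumOf_of_roots_isReduced` it gives the end point
`isReduced_of_isRootDatumOf_of_facts` below: **the named fact `isReduced_of_isRootDatumOf`
follows from those three structure-theoretic facts**, which are therefore the remaining DAG of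
`isReduced_of_isRootDatumOf_holds` (shared with `rootSubgroup_unique` and
`exists_isRootDatumOf`).

## References

* T. A. Springer, *Linear Algebraic Groups*, 2nd ed. (1998), 6.4.12, 7.1.4, 7.3.2, 7.3.3,
  7.4.3, 7.4.4, 7.6.4.
* M. Demazure, A. Grothendieck, *SGA 3*, Exp. XXII 1.14.
-/

open scoped IsMulCommutative MatrixGroups

namespace Literature.NumberTheory.Automorphic

variable {k : Type*} [Field k] {n : Type*} [Fintype n] [DecidableEq n]
variable {G T : Subgroup (GL n k)}

/-- **`exists_isRootDatumOf` implies Springer 7.4.4** (`roots_isReduced`): if `(G, T)` has a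
reduced root datum `P` (lang.S13 (b)), then roots of `(G, T)` which are proportional over `ℚ`
are `±` each other — they are roots of `P` (`range_root`), a relation `α ^ a = β ^ b` with
`a, b ≠ 0` makes the corresponding roots of `P` linearly dependent, `P.IsReduced` gives
`α = β^{±1}`, and `a = ±b` follows since `X*(T)` is torsion-free. [cite: SpringerLAG1998, 7.4.3–7.4.4] -/
theorem roots_isReduced_of_exists_isRootDatumOf
    (h : Literature.NumberTheory.Automorphic.exists_isRootDatumOf (G := G) (T := T)) :
    roots_isReduced (G := G) (T := T) := by
  intro _ hG hT α β hα hβ a b ha hb hab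
  haveI : IsMulCommutative ↥T := hT.2.1.2.1
  obtain ⟨ι, X, Y, _, _, _, P, eX, eY, hP, hred⟩ := h hG hT
  have hTconn : IsZConnected T := hT.2.1.1
  have htf := isMulTorsionFree_characterLattice hTconn
  have hα1 : α ≠ 1 := fun h1 => hα.1 (by rw [h1]; rfl)
  -- `α, β` are roots of `P`
  have hiα : eX (Additive.ofMul α) ∈ Set.range P.root := by
    rw [hP.range_root]; exact ⟨α, hα, rfl⟩
  have hiβ : eX (Additive.ofMul β) ∈ Set.range P.root := by
    rw [hP.range_root]; exact ⟨β, hβ, rfl⟩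
  obtain ⟨i, hi⟩ := hiα
  obtain ⟨j, hj⟩ := hiβ
  -- the relation `α ^ a = β ^ b` makes `P.root i, P.root j` linearly dependent
  have key : a • P.root i - b • P.root j = 0 := by
    have h' := congrArg (fun γ : ↥(characterLattice T) => eX (Additive.ofMul γ)) hab
    simp only [ofMul_zpow, map_zsmul] at h'
    rw [hi, hj, h', sub_self]
  have hdep : ¬ LinearIndependent ℤ ![P.root i, P.root j] := by
    rw [LinearIndependent.pair_iff]
    push Not
    exact ⟨a, -b, by rw [neg_smul, ← sub_eq_add_neg, key], fun h0 => (ha h0).elim⟩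
  rcases hred.eq_or_eq_neg i j hdep with hij | hij
  · -- `α = β`
    have hαβ : α = β := by
      apply Additive.ofMul.injective
      apply eX.injective
      rw [← hi, ← hj, hij]
    subst hαβ
    left
    rw [← div_eq_one, div_eq_mul_inv, ← zpow_sub] at hab
    exact sub_eq_zero.mp ((IsMulTorsionFree.zpow_eq_one_iff_right hα1).mp hab)
  · -- `α = β⁻¹`
    have hαβ : α = β⁻¹ := by
      apply Additive.ofMul.injective
      apply eX.injective
      rw [ofMul_inv, map_neg, ← hi, ← hj, hij]
    subst hαβ
    right
    have hβ1 : β ≠ 1 := fun h1 => hβ.1 (by rw [h1]; rfl)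
    rw [inv_zpow', ← div_eq_one, div_eq_mul_inv, ← zpow_sub] at hab
    have := (IsMulTorsionFree.zpow_eq_one_iff_right hβ1).mp hab
    omega

variable {ι X Y : Type*} [AddCommGroup X] [AddCommGroup Y] [IsMulCommutative ↥T]

/-- **`exists_isRootDatumOf` implies `isReduced_of_isRootDatumOf`**: if `(G, T)` has *some*
reduced root datum (lang.S13 (b)), then *every* root pairing over `ℤ` that is the root datum of
`(G, T)` is reduced (via `roots_isReduced_of_exists_isRootDatumOf` and
`isReduced_of_isRootDatumOf_of_roots_isReduced`). [cite: SpringerLAG1998, 7.4.3–7.4.4] -/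
theorem isReduced_of_isRootDatumOf_of_exists_isRootDatumOf
    (h : Literature.NumberTheory.Automorphic.exists_isRootDatumOf (G := G) (T := T)) :
    isReduced_of_isRootDatumOf (G := G) (T := T) (ι := ι) (X := X) (Y := Y) :=
  isReduced_of_isRootDatumOf_of_roots_isReduced (roots_isReduced_of_exists_isRootDatumOf h)

/-- **`isReduced_of_isRootDatumOf` from the structure theory** (Springer 7.4.3–7.4.4): granted
Springer 7.6.4 (i) (`isConnectedReductive_centralizer_torus`: centralisers of subtori of a
connected reductive group are connected reductive) and the two semisimple-rank-one facts of
`RootSubgroupProofs.lean` (`atMostTwo_isBorelIn_of_central`, 7.1.4 with 6.4.12;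
`exists_rootHom_sup_isBorelIn_of_central`, 7.3.3 (ii) with 7.3.2), every root pairing over `ℤ`
which is the root datum of a connected reductive group relative to a maximal torus over an
algebraically closed field is reduced: Lemma 7.4.4 is `roots_isReduced_of_facts`
(`ReductiveDualRankOne.lean`) and the passage to `RootPairing.IsReduced` is
`isReduced_of_isRootDatumOf_of_roots_isReduced` (`RootDataProofs.lean`). The conclusion is typed
literally as the named fact `isReduced_of_isRootDatumOf`. [cite: SpringerLAG1998, 7.4.3–7.4.4] -/
theorem isReduced_of_isRootDatumOf_of_facts
    (hA : isConnectedReductive_centralizer_torus (k := k) (n := n))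
    (hC₁ : atMostTwo_isBorelIn_of_central (k := k) (n := n))
    (hC₂ : exists_rootHom_sup_isBorelIn_of_central (k := k) (n := n)) :
    isReduced_of_isRootDatumOf (G := G) (T := T) (ι := ι) (X := X) (Y := Y) :=
  isReduced_of_isRootDatumOf_of_roots_isReduced (roots_isReduced_of_facts hA hC₁ hC₂)

end Literature.NumberTheory.Automorphic
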